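import Literature.AlgebraicGeometry.Resolution.CartierDivisorControlledTransform
import Literature.AlgebraicGeometry.Resolution.CartierDivisorReduced
import Literature.AlgebraicGeometry.Resolution.NormalCrossingsStrictification
import Literature.AlgebraicGeometry.Resolution.MonomialOrderReductionUnit
import Literature.AlgebraicGeometry.Resolution.BlowupsIntegral
import Literature.AlgebraicGeometry.Resolution.BlowupRestrictOpen
import HarnessLib

/-!
# The strict transform of a reduced Cartier divisor along a regular irreducible centre is reduced

Topic: `Literature/AlgebraicGeometry/Resolution`. Theorem-only file (sorry-free, no definitions, no named facts).

Setting of the tree's `CartierDivisorControlledTransform.lean` (res-hironaka brick (L-A)): `W` a regular integral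
Noetherian scheme, `C` an ideal sheaf with `V(C)` regular and irreducible with generic point `η`, `𝓗` an effective
Cartier divisor with `η ∈ V(𝓗)` and `ord_η 𝓗 = m`, and `τ : W' → W` the blowing up along `C`; the controlled transform
`τᶜ(𝓗, m) = 𝓘_E^{-m} τ^*𝓗` with the generic weight is the strict transform of the divisor (Kollár 2007, 3.30.2; tree
`IsBlowup.strictTransformIdeal_eq_controlledTransform`). THIS FILE: **if `𝓗` is reduced (`√𝓗 = 𝓗`) then so is
`τᶜ(𝓗, m)`, and `τᶜ(𝓗, m)` is the ideal sheaf of the closed set `cl(τ⁻¹(V(𝓗) ∖ V(C)))`.** Proof through the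
criterion «a Cartier divisor on a regular scheme is reduced iff it has order one at its codimension-one points» (tree
`CartierDivisorReduced.lean`): a codimension-one point `ζ'` of `Supp τᶜ(𝓗, m)` does not lie on the exceptional
divisor `E` — there `𝒪_{W',ζ'}` is a discrete valuation ring in which `E_{ζ'} = 𝔪_{ζ'}` (`E` is reduced, Liu 8.1.19 (b),
tree `IsBlowup.radical_comap_eq`) would contain `τᶜ(𝓗, m)_{ζ'} = 𝔪_{ζ'}^a`, `a ≥ 1`, against «the controlled transform
with the generic weight is prime to `E`» (tree `IsBlowup.not_stalkIdeal_controlledTransform_le_of_idealOrder_genericPoint_eq`,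
Cossart–Piltant 2008, (10)–(11)) — and off `E` the blowing up is a local isomorphism (Stacks 02OS), so `τ ζ'` is a
codimension-one point of `V(𝓗)` and `ord_{ζ'} τᶜ(𝓗, m) = ord_{τ ζ'} 𝓗 = 1`.

* `IsBlowup.not_mem_support_of_mem_divisorialPoints_controlledTransform` — codimension-one points of the controlled
  transform lie off the centre;
* `IsBlowup.idealOrder_controlledTransform_eq_of_not_mem` — off the centre `ord_{x'} τᶜ(𝓗, b) = ord_{τ x'} 𝓗`;
* `IsBlowup.radical_controlledTransform_eq` — **MAIN**: `√(τᶜ(𝓗, m)) = τᶜ(𝓗, m)` for reduced `𝓗`;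
* `IsBlowup.controlledTransform_eq_vanishingIdeal_closure` — `τᶜ(𝓗, m) = 𝓘(cl(τ⁻¹(V(𝓗) ∖ V(C))))`;
* `IsBlowup.isReduced_subscheme_controlledTransform` — the same in the language of reduced closed subschemes.

Use (res-hironaka, chain W5.2, T5-E «W₂B-maxweight», brick (L-D)): the CARRIED REDUCED HOST of the E-side transport
stays reduced, so at the end it is the ideal of Cossart–Jannsen–Saito's regular strict transform (`EndStateJ`).

## References
* J. Kollár, *Lectures on Resolution of Singularities* (2007), 3.30.2. [Kollar2007]
* Q. Liu, *Algebraic Geometry and Arithmetic Curves* (2002), Thm. 8.1.19 (b). [Liu2002]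
* V. Cossart, O. Piltant, J. Algebra 320 (2008), proof of Prop. 4.2, (10)–(11). [CossartPiltant2008]
* The Stacks Project, Tags 02OS, 0AFW, 0BE1. [StacksProject]
-/

noncomputable section

open CategoryTheory CategoryTheory.Limits AlgebraicGeometry TopologicalSpace IsLocalRing

namespace Literature.AlgebraicGeometry.Resolution

universe u

open Scheme.IdealSheafData

variable {W W' : Scheme.{u}} {τ : W' ⟶ W} {C 𝓗 : W.IdealSheafData} {η : W} {m : ℕ}

/-- An effective Cartier divisor on a nonempty scheme is not the zero ideal sheaf. [folklore] -/
private theorem IsEffectiveCartier.ne_bot' [Nonempty W] {J : W.IdealSheafData} (hJ : IsEffectiveCartier J) : J ≠ ⊥ := by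
  intro h0
  obtain ⟨U, hxU, g, hg, hU⟩ := hJ (Classical.arbitrary W)
  rw [h0, Scheme.IdealSheafData.ideal_bot, Pi.bot_apply, eq_comm, Ideal.span_singleton_eq_bot] at hU
  subst hU
  haveI : Nonempty (U : W.Opens) := ⟨⟨_, hxU⟩⟩
  exact zero_notMem_nonZeroDivisors hg

/-- **Orders off the centre**: at a point `x'` of the blowing up not over the centre, `ord_{x'} τᶜ(𝓗, b) = ord_{τ x'} 𝓗`
(the controlled transform is the total transform there, and `𝒪_{W, τ x'} ≅ 𝒪_{W', x'}`, Stacks 02OS).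
[cite: StacksProject, Tag 02OS] -/
theorem IsBlowup.idealOrder_controlledTransform_eq_of_not_mem (hτ : IsBlowup τ C) (b : ℕ) {x' : W'}
    (hx : τ x' ∉ (C.support : Set W)) : idealOrder (controlledTransform τ C 𝓗 b) x' = idealOrder 𝓗 (τ x') := by
  haveI := hτ.isIso_stalkMap_of_not_mem_support hx
  refine ENat.eq_of_forall_natCast_le_iff fun n => ?_
  rw [le_idealOrder_iff, le_idealOrder_iff, hτ.stalkIdeal_controlledTransform_of_not_mem 𝓗 b hx,
    stalkIdeal_comap_le_maximalIdeal_pow_iff_of_isIso_stalkMap τ 𝓗 x' n]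

/-- Codimension is preserved at points where the blowing up is a local isomorphism: `coheight (τ x') = coheight x'`
for `τ x'` off the centre (`𝒪_{W, τ x'} ≅ 𝒪_{W', x'}` and `dim 𝒪_{X,x} = coheight x`). [cite: StacksProject, Tag 02OS] -/
theorem IsBlowup.coheight_eq_of_not_mem (hτ : IsBlowup τ C) {x' : W'} (hx : τ x' ∉ (C.support : Set W)) :
    Order.coheight (τ x') = Order.coheight x' := by
  haveI := hτ.isIso_stalkMap_of_not_mem_support hx
  let e : W.presheaf.stalk (τ x') ≃+* W'.presheaf.stalk x' := (asIso (τ.stalkMap x')).commRingCatIsoToRingEquiv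
  have h := ringKrullDim_eq_of_ringEquiv e
  rw [ringKrullDim_stalk_eq_coheight, ringKrullDim_stalk_eq_coheight] at h
  exact_mod_cast h

/-- **Codimension-one points of the controlled transform with the generic weight lie OFF the centre.** With `W`
regular integral Noetherian, `V(C)` regular irreducible with generic point `η ∈ V(𝓗)`, `ord_η 𝓗 = m`, `𝓗` effective
Cartier: at a codimension-one point `ζ'` of `Supp τᶜ(𝓗, m)` over the centre, `𝒪_{W',ζ'}` is a discrete valuation ring,
`𝓘_{E,ζ'} = 𝔪_{ζ'}` (`E` is reduced) and `τᶜ(𝓗, m)_{ζ'} = 𝔪_{ζ'}^a` with `a ≥ 1` — so `τᶜ(𝓗, m)_{ζ'} ⊆ 𝓘_{E,ζ'}`, which the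
generic-weight controlled transform forbids. [cite: CossartPiltant2008, proof of Prop. 4.2, (10)–(11)]
[cite: Liu2002, Thm. 8.1.19 (b)] -/
theorem IsBlowup.not_mem_support_of_mem_divisorialPoints_controlledTransform [IsIntegral W] [IsNoetherian W]
    (hW : Scheme.IsRegular W) (hC : Scheme.IsRegular C.subscheme) (hη : IsGenericPoint η (C.support : Set W))
    (hηH : η ∈ 𝓗.support) (hm : idealOrder 𝓗 η = m) (h𝓗 : IsEffectiveCartier 𝓗) (hτ : IsBlowup τ C) {ζ' : W'}
    (hζ' : ζ' ∈ divisorialPoints (controlledTransform τ C 𝓗 m)) : τ ζ' ∉ (C.support : Set W) := by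
  intro hx
  have hint : interior (C.support : Set W) = ∅ := interior_eq_empty_of_isGenericPoint_of_mem_support hη h𝓗 hηH
  have hCne : C ≠ ⊥ := by
    intro h0
    rw [h0, Scheme.IdealSheafData.support_bot] at hint
    simp at hint
  haveI : IsIntegral W' := hτ.isIntegral hCne
  haveI : IsNoetherian W' := isNoetherian_of_isBlowup hτ
  have hW' : Scheme.IsRegular W' := IsBlowup.isRegular_of_isRegular_subscheme hW hC hτ
  have hle : 𝓗 ≤ C ^ m := le_pow_of_idealOrder_genericPoint_eq hW hC hη hm
  set K := controlledTransform τ C 𝓗 m with hK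
  have hKc : IsEffectiveCartier K := hτ.isEffectiveCartier_controlledTransform_of_le_pow h𝓗 hle
  have hKne : K ≠ ⊥ := hKc.ne_bot'
  -- the exceptional ideal `E = C𝒪` is radical, non-zero, and passes through `ζ'`
  set E := C.comap τ with hE
  have hErad : E.radical = E := hτ.radical_comap_eq hW hC
  have hEne : E ≠ ⊥ := hτ.isEffectiveCartier.ne_bot'
  have hζE : ζ' ∈ E.support := by rw [hE, support_comap]; exact hx
  -- `E_{ζ'} = 𝔪`, `K_{ζ'} = 𝔪^a` with `a ≥ 1`
  have hE1 : idealOrder E ζ' = 1 := idealOrder_eq_one_of_radical_eq hW' hEne hErad ⟨hζE, hζ'.2⟩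
  obtain ⟨b, hb, hbe⟩ := exists_stalkIdeal_eq_maximalIdeal_pow hW' hζ'.2 hEne
  have hb1 : b = 1 := by
    have : ((b : ℕ) : ℕ∞) = 1 := hb.symm.trans hE1
    exact_mod_cast this
  obtain ⟨a, ha, hae⟩ := exists_stalkIdeal_eq_maximalIdeal_pow hW' hζ'.2 hKne
  have ha1 : 1 ≤ a := by
    have h1 : (1 : ℕ∞) ≤ idealOrder K ζ' := (one_le_idealOrder_iff K ζ').mpr hζ'.1
    rw [ha] at h1
    exact_mod_cast h1
  have hKE : stalkIdeal K ζ' ≤ stalkIdeal E ζ' := by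
    rw [hae, hbe, hb1]
    exact Ideal.pow_le_pow_right ha1
  -- against the generic-weight controlled transform being prime to `E`
  obtain ⟨D, rfl⟩ : ∃ D : Closeds W, C = vanishingIdeal D := ⟨_, eq_vanishingIdeal_support_of_isRegular C hC⟩
  have hDsupp : ((vanishingIdeal D).support : Set W) = D := coe_support_vanishingIdeal D
  rw [hDsupp] at hη hint hx
  exact hτ.not_stalkIdeal_controlledTransform_le_of_idealOrder_genericPoint_eq hW hC hη hint hm hx hKE

/-- **The controlled transform with the generic weight of a REDUCED Cartier divisor is reduced**: `W` regular
integral Noetherian, `V(C)` regular irreducible with generic point `η ∈ V(𝓗)`, `ord_η 𝓗 = m`, `𝓗` effective Cartier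
with `√𝓗 = 𝓗`, `τ` the blowing up along `C` ⇒ `√(τᶜ(𝓗, m)) = τᶜ(𝓗, m)` (its codimension-one points lie off the
centre, where the orders are those of `𝓗`, namely one). [cite: Kollar2007, 3.30.2] [cite: StacksProject, Tag 0AFW] -/
theorem IsBlowup.radical_controlledTransform_eq [IsIntegral W] [IsNoetherian W] (hW : Scheme.IsRegular W)
    (hC : Scheme.IsRegular C.subscheme) (hη : IsGenericPoint η (C.support : Set W)) (hηH : η ∈ 𝓗.support)
    (hm : idealOrder 𝓗 η = m) (h𝓗 : IsEffectiveCartier 𝓗) (hrad : 𝓗.radical = 𝓗) (hτ : IsBlowup τ C) :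
    (controlledTransform τ C 𝓗 m).radical = controlledTransform τ C 𝓗 m := by
  have hint : interior (C.support : Set W) = ∅ := interior_eq_empty_of_isGenericPoint_of_mem_support hη h𝓗 hηH
  have hCne : C ≠ ⊥ := by
    intro h0
    rw [h0, Scheme.IdealSheafData.support_bot] at hint
    simp at hint
  haveI : IsIntegral W' := hτ.isIntegral hCne
  haveI : IsNoetherian W' := isNoetherian_of_isBlowup hτ
  have hW' : Scheme.IsRegular W' := IsBlowup.isRegular_of_isRegular_subscheme hW hC hτ
  have hle : 𝓗 ≤ C ^ m := le_pow_of_idealOrder_genericPoint_eq hW hC hη hm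
  have hKc : IsEffectiveCartier (controlledTransform τ C 𝓗 m) :=
    hτ.isEffectiveCartier_controlledTransform_of_le_pow h𝓗 hle
  have h𝓗ne : 𝓗 ≠ ⊥ := h𝓗.ne_bot'
  refine radical_eq_of_isLocallyPrincipal_of_forall_idealOrder_eq_one hW' hKc.ne_bot' hKc.isLocallyPrincipal
    fun ζ' hζ' => ?_
  have hoff : τ ζ' ∉ (C.support : Set W) :=
    hτ.not_mem_support_of_mem_divisorialPoints_controlledTransform hW hC hη hηH hm h𝓗 hζ'
  rw [hτ.idealOrder_controlledTransform_eq_of_not_mem m hoff]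
  refine idealOrder_eq_one_of_radical_eq hW h𝓗ne hrad ⟨?_, ?_⟩
  · exact (hτ.mem_support_controlledTransform_iff_of_not_mem m hoff).mp hζ'.1
  · rw [hτ.coheight_eq_of_not_mem hoff]
    exact hζ'.2

/-- **The controlled transform with the generic weight of a reduced Cartier divisor IS the ideal of the closed set
`cl(τ⁻¹(V(𝓗) ∖ V(C)))`** — the strict transform of the reduced divisor as a reduced closed subscheme.
[cite: Kollar2007, 3.30.2] -/
theorem IsBlowup.controlledTransform_eq_vanishingIdeal_closure [IsIntegral W] [IsNoetherian W] (hW : Scheme.IsRegular W)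
    (hC : Scheme.IsRegular C.subscheme) (hη : IsGenericPoint η (C.support : Set W)) (hηH : η ∈ 𝓗.support)
    (hm : idealOrder 𝓗 η = m) (h𝓗 : IsEffectiveCartier 𝓗) (hrad : 𝓗.radical = 𝓗) (hτ : IsBlowup τ C) :
    controlledTransform τ C 𝓗 m =
      vanishingIdeal ⟨closure (τ ⁻¹' ((𝓗.support : Set W) \ C.support)), isClosed_closure⟩ := by
  have hsupp : (controlledTransform τ C 𝓗 m).support =
      (⟨closure (τ ⁻¹' ((𝓗.support : Set W) \ C.support)), isClosed_closure⟩ : Closeds W') :=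
    Closeds.ext (hτ.support_controlledTransform_eq_closure_of_mem_support hW hC hη hηH hm h𝓗)
  rw [← hsupp, vanishingIdeal_support, hτ.radical_controlledTransform_eq hW hC hη hηH hm h𝓗 hrad]

/-- The same in the language of reduced closed subschemes: `V(𝓗)` reduced ⇒ `V(τᶜ(𝓗, m))` reduced.
[cite: Kollar2007, 3.30.2] [cite: Liu2002, Thm. 8.1.19 (b)] -/
theorem IsBlowup.isReduced_subscheme_controlledTransform [IsIntegral W] [IsNoetherian W] (hW : Scheme.IsRegular W)
    (hC : Scheme.IsRegular C.subscheme) (hη : IsGenericPoint η (C.support : Set W)) (hηH : η ∈ 𝓗.support)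
    (hm : idealOrder 𝓗 η = m) (h𝓗 : IsEffectiveCartier 𝓗) [IsReduced 𝓗.subscheme] (hτ : IsBlowup τ C) :
    IsReduced (controlledTransform τ C 𝓗 m).subscheme := by
  rw [isReduced_subscheme_iff_radical_eq]
  exact hτ.radical_controlledTransform_eq hW hC hη hηH hm h𝓗
    ((isReduced_subscheme_iff_radical_eq 𝓗).mp inferInstance)

end Literature.AlgebraicGeometry.Resolution

end
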